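import Mathlib
import HarnessLib
import Literature.NumberTheory.Sieve.BatemanHorn
import Literature.NumberTheory.Sieve.AletheiaZomleferFukshanskyGarcia2020Applications
import Summits.Parity.BatemanHorn.Theses.AlmostPrimeZeros
import Summits.Parity.BatemanHorn.Theorems.AlmostPrimeZerosExtractionAtZeroAux

/-!
# What the far leaf `FarMomentWide` contains on the `Σ deg = 2` class: friable twins and friable
values of `X² + 1` (necessity companions, lead c7 of crux stmt-Parity-11291)

Crux `AlmostPrimeZeros.SystemZeroRepulsion` (stmt-Parity-11291) is closed by the landed glue
`Reduction.SystemZeroRepulsion_of_discMajorantLog_of_farMomentWide` (p96203) from the near leaf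
`DiscMajorantLog` (stmt-Parity-17114) and the far leaf `FarMomentWide` (stmt-Parity-17115):
`Σ_{n ≤ x} t^{s_f(n)} ≤ (x+1)·exp(C(t·L + t²/L))`, `L = log log x`, `1 ≤ t ≤ √log x`, for the capped
statistic `s_f(n) = Σ_i Σ_{p^v ∥ f_i(n)} min(v, 2)`.  The far leaf is parity-free ANATOMY; this file
records, kernel-checked and with no new definition, the simplest named statements it CONTAINS on the
first open class (`k = 2` linear: the twin system `(X, X+2)`; `k = 1`, `deg 2`: `X² + 1`):

* `friableTwins_mul_pow_le` — for the twin system, the per-system far moment bound with constant `C`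
  forces, for every `x ≥ 3`, `y ≥ 1`, `m`, and every tilt `1 ≤ t ≤ √log x`,
  `#{n ≤ x : y^m < n, n and n+2 squarefree and y-friable} · t^{2(m+1)} ≤ (x+1)·exp(C(tL + t²/L))`
  (a squarefree `y`-friable `n > y^m` has `ω(n) ≥ m+1`, and `s(n) ≥ ω(n)`);
* `friableValuesXSqAddOne_mul_pow_le` — the same for `X² + 1`:
  `#{n ≤ x : y^m < n²+1, n²+1 squarefree and y-friable} · t^{m+1} ≤ (x+1)·exp(C(tL + t²/L))`;
* `friableTwins_of_farMomentWide`, `friableValuesXSqAddOne_of_farMomentWide` — the same from the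
  route decl `FarMomentWide` itself (via `isBatemanHornSystem_twinSystem`,
  `isBatemanHornSystem_X_sq_add_one`).

Why this is worth recording (numbers in `Cruxes/SystemZeroRepulsion/FAR-NECESSITY-c7.md`): with
`y = x^{1/u}` and the choice `t = √(uL/C)` the first bullet reads
`#{friable squarefree twins in (x/2, x]} ≤ (x+1)(eC/(uL))^{u}·e^{√(Cu)L^{3/2}}`, i.e. for
`(log log x)³ ≤ u ≤ (log x)^{1−ε}` an improvement of the one-member bound `Ψ(x, y) ∼ xρ(u)`,
`ρ(u) = exp(−u(log u + log log u + O(1)))`, by the factor `(C' log u/ log log x)^{u}` — and for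
`X² + 1` an improvement of Khmyrova's `Ψ_{X²+1}(x, x^{1/u}) ≪ x(e/u)^u` (Dokl. 1964; Granville 2008
§4.3) by `(C'/log log x)^{u}` — neither of which is in print (Granville, *Smooth numbers*, MSRI Publ.
44 (2008) §4.3, §5.5: lower bounds / fixed `u` only; the one printed route beyond, level of
distribution `x^{1+η}` for quadratic polynomials, de la Bretèche–Drappeau JEMS 2020, reaches only
`u ≥ (log log x)^{1/η}` of this range).  So the far leaf is at least as hard as Martin-type upper
bounds (J. Number Theory 93 (2002), conj. (1.20)) for friable values of `X(X+2)` and `X²+1` with a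
saving tending to zero per prime, uniformly in `u → ∞` — the parity-free analogue of the necessity
theorems `stub_liouvilleSaving` (p87976) / `liouvilleSaving_of_discMajorant` (p96296) on the near side.
-/

noncomputable section

namespace Summit.Parity.BatemanHorn.Cruxes.SystemZeroRepulsion.FarNecessity

open Finset Real Polynomial
open Literature.NumberTheory.Sieve
open Summit.Parity.BatemanHorn.Theses.AlmostPrimeZeros
open scoped Classical
open Summit.Parity.BatemanHorn.Theorems (AlmostPrimeZerosExtraction.card_primeFactors_le_factorization_sum_min_two)

/-! ## Two elementary lemmas (`ω(N) ≤ s(N)` is the tree lemma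
`AlmostPrimeZerosExtraction.card_primeFactors_le_factorization_sum_min_two`, used by name below) -/

/-- Chernoff/Markov for a tilted count: for `t ≥ 1`, the number of `n ∈ S` with `m ≤ e n`, times
`t^m`, is at most `Σ_{n ∈ S} t^{e n}`. [folklore] -/
theorem card_filter_mul_pow_le_sum (S : Finset ℕ) (e : ℕ → ℕ) (m : ℕ) {t : ℝ} (ht : 1 ≤ t) :
    ((S.filter fun n : ℕ => m ≤ e n).card : ℝ) * t ^ m ≤ ∑ n ∈ S, t ^ e n := by
  have ht0 : 0 ≤ t := zero_le_one.trans ht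
  calc ((S.filter fun n : ℕ => m ≤ e n).card : ℝ) * t ^ m
      = ∑ _n ∈ S.filter (fun n => m ≤ e n), t ^ m := by
        rw [Finset.sum_const, nsmul_eq_mul]
    _ ≤ ∑ n ∈ S.filter (fun n => m ≤ e n), t ^ e n := by
        refine Finset.sum_le_sum fun n hn => ?_
        exact pow_le_pow_right₀ ht (Finset.mem_filter.1 hn).2
    _ ≤ ∑ n ∈ S, t ^ e n :=
        Finset.sum_le_sum_of_subset_of_nonneg (Finset.filter_subset _ _)
          fun n _ _ => pow_nonneg ht0 _

/-- A squarefree `N` all of whose prime factors are `≤ y` (`y ≥ 1`) with `y ^ m < N` has more than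
`m` distinct prime factors: `N = ∏_{p ∣ N} p ≤ y^{ω(N)}`. [folklore] -/
theorem lt_card_primeFactors_of_squarefree {N y m : ℕ} (hN : Squarefree N) (hy1 : 1 ≤ y)
    (hy : ∀ p ∈ N.primeFactors, p ≤ y) (hm : y ^ m < N) : m < N.primeFactors.card := by
  by_contra h
  push Not at h
  have h1 : N ≤ y ^ N.primeFactors.card := by
    calc N = ∏ p ∈ N.primeFactors, p := (Nat.prod_primeFactors_of_squarefree hN).symm
      _ ≤ ∏ _p ∈ N.primeFactors, y :=
          Finset.prod_le_prod (fun p _ => Nat.zero_le p) fun p hp => hy p hp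
      _ = y ^ N.primeFactors.card := by rw [Finset.prod_const]
  have h2 : y ^ N.primeFactors.card ≤ y ^ m := Nat.pow_le_pow_right hy1 h
  omega

/-! ## The twin system `(X, X + 2)` -/

/-- The capped statistic of the twin system at `n` is `s(n) + s(n+2)`. -/
theorem twin_stat (n : ℕ) :
    (∑ i, (((twinSystem i).eval (n : ℤ)).toNat.factorization.sum fun _ v => min v 2)) =
      (n.factorization.sum fun _ v => min v 2) + ((n + 2).factorization.sum fun _ v => min v 2) := by
  have h2 : ((n : ℤ) + 2).toNat = n + 2 := by
    have : ((n : ℤ) + 2) = ((n + 2 : ℕ) : ℤ) := by push_cast; ring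
    rw [this, Int.toNat_natCast]
  simp [twinSystem, Fin.sum_univ_two, h2]

/-- For the twin system: if `n` and `n + 2` are squarefree and `y`-friable and `y^m < n`, then
`2(m+1) ≤ s(n) + s(n+2)`. -/
theorem twin_stat_ge {n y m : ℕ} (hy1 : 1 ≤ y) (hm : y ^ m < n) (hsq : Squarefree n)
    (hsq2 : Squarefree (n + 2)) (hfr : ∀ p ∈ n.primeFactors, p ≤ y)
    (hfr2 : ∀ p ∈ (n + 2).primeFactors, p ≤ y) :
    2 * (m + 1) ≤ ∑ i, (((twinSystem i).eval (n : ℤ)).toNat.factorization.sum fun _ v => min v 2) := by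
  rw [twin_stat]
  have h1 : m < n.primeFactors.card := lt_card_primeFactors_of_squarefree hsq hy1 hfr hm
  have h2 : m < (n + 2).primeFactors.card :=
    lt_card_primeFactors_of_squarefree hsq2 hy1 hfr2 (lt_of_lt_of_le hm (Nat.le_add_right n 2))
  have h3 := AlmostPrimeZerosExtraction.card_primeFactors_le_factorization_sum_min_two n
  have h4 := AlmostPrimeZerosExtraction.card_primeFactors_le_factorization_sum_min_two (n + 2)
  omega

/-- **Friable squarefree twins are in the far leaf (per-system form).**  If the wide far moment holds
for the twin system `(X, X+2)` with constant `C`, then for all `x ≥ 3`, `y ≥ 1`, `m`, and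
`1 ≤ t ≤ √log x`:
`#{n ≤ x : y^m < n, n and n+2 squarefree and y-friable} · t^{2(m+1)} ≤ (x+1)·exp(C(tL + t²/L))`.
With `y = x^{1/u}`, `t = √(uL/C)` this is `≤ (x+1)(eC/(uL))^{u} e^{√(Cu) L^{3/2}}`, beyond the printed
one-member bound `Ψ(x, y) ∼ xρ(u)` by `(C' log u/L)^u` for `L³ ≤ u ≤ (log x)^{1−ε}`
(see the file docstring). -/
theorem friableTwins_mul_pow_le {C : ℝ}
    (hC : ∀ x : ℕ, 3 ≤ x → ∀ t : ℝ, 1 ≤ t → t ≤ Real.sqrt (Real.log (x : ℝ)) →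
      (∑ n ∈ Finset.range (x + 1),
          (t : ℝ) ^ (∑ i, (((twinSystem i).eval (n : ℤ)).toNat.factorization.sum fun _ v => min v 2))) ≤
        ((x : ℝ) + 1) *
          Real.exp (C * (t * Real.log (Real.log (x : ℝ)) + t ^ 2 / Real.log (Real.log (x : ℝ)))))
    (x : ℕ) (hx : 3 ≤ x) (y m : ℕ) (hy1 : 1 ≤ y) (t : ℝ) (ht1 : 1 ≤ t)
    (ht2 : t ≤ Real.sqrt (Real.log (x : ℝ))) :
    (((Finset.range (x + 1)).filter fun n : ℕ =>
          y ^ m < n ∧ Squarefree n ∧ Squarefree (n + 2) ∧ (∀ p ∈ n.primeFactors, p ≤ y) ∧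
            ∀ p ∈ (n + 2).primeFactors, p ≤ y).card : ℝ) * t ^ (2 * (m + 1)) ≤
      ((x : ℝ) + 1) *
        Real.exp (C * (t * Real.log (Real.log (x : ℝ)) + t ^ 2 / Real.log (Real.log (x : ℝ)))) := by
  have ht0 : 0 ≤ t := zero_le_one.trans ht1
  have hsub : ((Finset.range (x + 1)).filter fun n : ℕ =>
          y ^ m < n ∧ Squarefree n ∧ Squarefree (n + 2) ∧ (∀ p ∈ n.primeFactors, p ≤ y) ∧
            ∀ p ∈ (n + 2).primeFactors, p ≤ y) ⊆
        (Finset.range (x + 1)).filter fun n : ℕ =>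
          2 * (m + 1) ≤
            ∑ i, (((twinSystem i).eval (n : ℤ)).toNat.factorization.sum fun _ v => min v 2) := by
    intro n hn
    simp only [Finset.mem_filter] at hn ⊢
    obtain ⟨hnx, hm, hsq, hsq2, hfr, hfr2⟩ := hn
    exact ⟨hnx, twin_stat_ge hy1 hm hsq hsq2 hfr hfr2⟩
  have hcard : ((((Finset.range (x + 1)).filter fun n : ℕ =>
          y ^ m < n ∧ Squarefree n ∧ Squarefree (n + 2) ∧ (∀ p ∈ n.primeFactors, p ≤ y) ∧
            ∀ p ∈ (n + 2).primeFactors, p ≤ y).card : ℕ) : ℝ) ≤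
      ((((Finset.range (x + 1)).filter fun n : ℕ =>
          2 * (m + 1) ≤
            ∑ i, (((twinSystem i).eval (n : ℤ)).toNat.factorization.sum fun _ v => min v 2)).card :
          ℕ) : ℝ) := by
    exact_mod_cast Finset.card_le_card hsub
  refine le_trans (mul_le_mul_of_nonneg_right hcard (pow_nonneg ht0 _)) ?_
  exact (card_filter_mul_pow_le_sum (Finset.range (x + 1))
    (fun n : ℕ => ∑ i, (((twinSystem i).eval (n : ℤ)).toNat.factorization.sum fun _ v => min v 2))
    (2 * (m + 1)) ht1).trans (hC x hx t ht1 ht2)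

/-- **Friable squarefree twins are in the far leaf (route form).**  `FarMomentWide` gives a constant
`C` (that of the twin system) with the conclusion of `friableTwins_mul_pow_le`. -/
theorem friableTwins_of_farMomentWide :
    Summit.Parity.BatemanHorn.Theses.AlmostPrimeZeros.FarMomentWide → ∃ C : ℝ, ∀ x : ℕ, 3 ≤ x → ∀ y m : ℕ, 1 ≤ y → ∀ t : ℝ, 1 ≤ t → t ≤ Real.sqrt (Real.log (x : ℝ)) → (((Finset.range (x + 1)).filter fun n : ℕ => y ^ m < n ∧ Squarefree n ∧ Squarefree (n + 2) ∧ (∀ p ∈ n.primeFactors, p ≤ y) ∧ ∀ p ∈ (n + 2).primeFactors, p ≤ y).card : ℝ) * t ^ (2 * (m + 1)) ≤ ((x : ℝ) + 1) * Real.exp (C * (t * Real.log (Real.log (x : ℝ)) + t ^ 2 / Real.log (Real.log (x : ℝ)))) := by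
  intro h
  obtain ⟨C, hC⟩ := h 2 twinSystem isBatemanHornSystem_twinSystem
  exact ⟨C, fun x hx y m hy1 t ht1 ht2 => friableTwins_mul_pow_le hC x hx y m hy1 t ht1 ht2⟩

/-! ## The system `X² + 1` -/

/-- The capped statistic of the system `![X² + 1]` at `n` is `s(n² + 1)`. -/
theorem xSqAddOne_stat (n : ℕ) :
    (∑ i, (((![(X ^ 2 + 1 : ℤ[X])] i).eval (n : ℤ)).toNat.factorization.sum fun _ v => min v 2)) =
      ((n ^ 2 + 1).factorization.sum fun _ v => min v 2) := by
  have h2 : ((n : ℤ) ^ 2 + 1).toNat = n ^ 2 + 1 := by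
    have : ((n : ℤ) ^ 2 + 1) = ((n ^ 2 + 1 : ℕ) : ℤ) := by push_cast; ring
    rw [this, Int.toNat_natCast]
  simp [h2]

/-- **Friable squarefree values of `X² + 1` are in the far leaf (per-system form).**  If the wide
far moment holds for `![X² + 1]` with constant `C`, then for all `x ≥ 3`, `y ≥ 1`, `m`,
`1 ≤ t ≤ √log x`:
`#{n ≤ x : y^m < n²+1, n²+1 squarefree and y-friable} · t^{m+1} ≤ (x+1)·exp(C(tL + t²/L))`.
With `y = x^{1/u}` (so `m + 1 ≈ 2u` on `(x/2, x]`), `t = √(uL/C)`: `≤ (x+1)(eC/(uL))^{u}e^{√(Cu)L^{3/2}}`,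
beyond Khmyrova's `x(e/u)^u` by `(C'/L)^u` for `L³ ≤ u ≤ (log x)^{1−ε}` (file docstring). -/
theorem friableValuesXSqAddOne_mul_pow_le {C : ℝ}
    (hC : ∀ x : ℕ, 3 ≤ x → ∀ t : ℝ, 1 ≤ t → t ≤ Real.sqrt (Real.log (x : ℝ)) →
      (∑ n ∈ Finset.range (x + 1),
          (t : ℝ) ^ (∑ i, (((![(X ^ 2 + 1 : ℤ[X])] i).eval (n : ℤ)).toNat.factorization.sum
            fun _ v => min v 2))) ≤
        ((x : ℝ) + 1) *
          Real.exp (C * (t * Real.log (Real.log (x : ℝ)) + t ^ 2 / Real.log (Real.log (x : ℝ)))))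
    (x : ℕ) (hx : 3 ≤ x) (y m : ℕ) (hy1 : 1 ≤ y) (t : ℝ) (ht1 : 1 ≤ t)
    (ht2 : t ≤ Real.sqrt (Real.log (x : ℝ))) :
    (((Finset.range (x + 1)).filter fun n : ℕ =>
          y ^ m < n ^ 2 + 1 ∧ Squarefree (n ^ 2 + 1) ∧ ∀ p ∈ (n ^ 2 + 1).primeFactors, p ≤ y).card : ℝ) *
        t ^ (m + 1) ≤
      ((x : ℝ) + 1) *
        Real.exp (C * (t * Real.log (Real.log (x : ℝ)) + t ^ 2 / Real.log (Real.log (x : ℝ)))) := by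
  have ht0 : 0 ≤ t := zero_le_one.trans ht1
  have hsub : ((Finset.range (x + 1)).filter fun n : ℕ =>
          y ^ m < n ^ 2 + 1 ∧ Squarefree (n ^ 2 + 1) ∧ ∀ p ∈ (n ^ 2 + 1).primeFactors, p ≤ y) ⊆
        (Finset.range (x + 1)).filter fun n : ℕ =>
          m + 1 ≤
            ∑ i, (((![(X ^ 2 + 1 : ℤ[X])] i).eval (n : ℤ)).toNat.factorization.sum
              fun _ v => min v 2) := by
    intro n hn
    simp only [Finset.mem_filter] at hn ⊢
    obtain ⟨hnx, hm, hsq, hfr⟩ := hn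
    refine ⟨hnx, ?_⟩
    rw [xSqAddOne_stat]
    have h1 : m < (n ^ 2 + 1).primeFactors.card := lt_card_primeFactors_of_squarefree hsq hy1 hfr hm
    have h3 := AlmostPrimeZerosExtraction.card_primeFactors_le_factorization_sum_min_two (n ^ 2 + 1)
    omega
  have hcard : ((((Finset.range (x + 1)).filter fun n : ℕ =>
          y ^ m < n ^ 2 + 1 ∧ Squarefree (n ^ 2 + 1) ∧
            ∀ p ∈ (n ^ 2 + 1).primeFactors, p ≤ y).card : ℕ) : ℝ) ≤
      ((((Finset.range (x + 1)).filter fun n : ℕ =>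
          m + 1 ≤
            ∑ i, (((![(X ^ 2 + 1 : ℤ[X])] i).eval (n : ℤ)).toNat.factorization.sum
              fun _ v => min v 2)).card : ℕ) : ℝ) := by
    exact_mod_cast Finset.card_le_card hsub
  refine le_trans (mul_le_mul_of_nonneg_right hcard (pow_nonneg ht0 _)) ?_
  exact (card_filter_mul_pow_le_sum (Finset.range (x + 1))
    (fun n : ℕ => ∑ i, (((![(X ^ 2 + 1 : ℤ[X])] i).eval (n : ℤ)).toNat.factorization.sum
      fun _ v => min v 2)) (m + 1) ht1).trans (hC x hx t ht1 ht2)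

/-- **Friable squarefree values of `X² + 1` are in the far leaf (route form).** -/
theorem friableValuesXSqAddOne_of_farMomentWide :
    Summit.Parity.BatemanHorn.Theses.AlmostPrimeZeros.FarMomentWide → ∃ C : ℝ, ∀ x : ℕ, 3 ≤ x → ∀ y m : ℕ, 1 ≤ y → ∀ t : ℝ, 1 ≤ t → t ≤ Real.sqrt (Real.log (x : ℝ)) → (((Finset.range (x + 1)).filter fun n : ℕ => y ^ m < n ^ 2 + 1 ∧ Squarefree (n ^ 2 + 1) ∧ ∀ p ∈ (n ^ 2 + 1).primeFactors, p ≤ y).card : ℝ) * t ^ (m + 1) ≤ ((x : ℝ) + 1) * Real.exp (C * (t * Real.log (Real.log (x : ℝ)) + t ^ 2 / Real.log (Real.log (x : ℝ)))) := by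
  intro h
  obtain ⟨C, hC⟩ := h 1 ![(X ^ 2 + 1 : ℤ[X])] isBatemanHornSystem_X_sq_add_one
  exact ⟨C, fun x hx y m hy1 t ht1 ht2 =>
    friableValuesXSqAddOne_mul_pow_le hC x hx y m hy1 t ht1 ht2⟩

end Summit.Parity.BatemanHorn.Cruxes.SystemZeroRepulsion.FarNecessity
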